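import Summits.Ventures.CertifiedManyBodySolver.Certificates.EmeryRing8_SLCOx_splitNodes_j310438
import Summits.Ventures.CertifiedManyBodySolver.Certificates.EmeryRing8_NdNiO2x_splitNodes_j310438
import Summits.Ventures.CertifiedManyBodySolver.Downfold.EmeryBoxesSLCOClassFloorWord
import Summits.Ventures.CertifiedManyBodySolver.Downfold.EmeryBoxesNdNiO2SliceFloorWord
import HarnessLib

/-!
# Ring-8 CONDITIONAL WORDS on the Sr₀.₉La₀.₁CuO₂ class box (`emeryBoxSLCOClass`, mod-4 p643236) and the NdNiO₂ U-slice box (`emeryBoxNdNiO2Dxy459YK26`, p643200)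

Venture CertifiedManyBodySolver; cell `pub/hubbard-fast`, S2 (iv) multi-band; seat hubbard-box-p3 g19. Companion of `EmeryRing8_batch2_words_j310438`: the claim nodes and the
conditional corner / line floors are in `EmeryRing8_{SLCOx,NdNiO2x}_splitNodes_j310438` (kit j310438); here the `rfl` bridges `ring8SLCOCorner = slcoClassCorner`,
`ring8NdNiO2Corner = ndNiO2Dxy459YK26Corner` and the words through mod-4's device-free seam `holdsOn_emeryEnergyFloor_of_lowerCorners`:
* SLCO (row 55, ρ = 51/40): line word on ρ ∈ [0, 3/2], **`e ≥ 3.2006250` eV/site = 12.8025 eV/CuO₂ at ρ = 51/40** (mod-4 plus word `emeryBoxSLCOClass_cuprate_energyFloor`: 12.294 eV/CuO₂);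
* NdNiO₂ (row 99, La-proxy U-slice, ρ = 491/400): line word on ρ ∈ [0, 3/2], **`e ≥ 2.4990625` eV/site = 9.9962 eV/NiO₂ at ρ = 491/400** (plus word 9.3233).

HONEST FRAMING: CONDITIONAL on the four claim nodes of each sheet (replay layer until kernel discharge / referee PASS F2-124); energy words on SCREENING-GRADE boxes; no phase sentence.

* P. W. Anderson, Phys. Rev. 83 (1951) 1260, eq. (2). [cite: Anderson1951, eq. (2)]
* R. B. Israel, Convexity in the theory of lattice gases (1979), Thm. I.3.4. [cite: Israel1979, Thm. I.3.4]
-/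

noncomputable section

namespace Summit.Ventures.CertifiedManyBodySolver.Certificates

open Literature.MathematicalPhysics.QuantumLattice Literature.Probability.LatticeModels
open Summit.Ventures.CertifiedManyBodySolver.Downfold
open scoped BigOperators ComplexOrder

/-! ## Sr₀.₉La₀.₁CuO₂ class box -/

/-- My literal corner sheet of row 55 IS mod-4's `slcoClassCorner`. [folklore] -/
theorem ring8SLCOCorner_eq : ring8SLCOCorner = slcoClassCorner := rfl

/-- **CONDITIONAL RING-8 FILLING-LINE WORD on `emeryBoxSLCOClass`**: for every fixed `ρ ∈ [0, 3/2]`,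
`e(·, ρ) ≥ ring8SLCOFloorLine ρ` on the whole box — given the four claim nodes. [cite: Anderson1951, eq. (2)] [cite: Israel1979, Thm. I.3.4] -/
theorem emeryBoxSLCOClass_cuprate_energyFloorLine_ring8_of_nodes (h0 : cert_emeryRing8_SLCOx_c0_j310438) (h1 : cert_emeryRing8_SLCOx_c1_j310438) (h2 : cert_emeryRing8_SLCOx_c2_j310438) (h3 : cert_emeryRing8_SLCOx_c3_j310438) {ρ : ℝ}
    (hρ : ρ ∈ Set.Icc (0 : ℝ) (3/2)) :
    HoldsOn (fun p : EmeryCoord → ℝ =>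
      ring8SLCOFloorLine ρ ≤ emeryEnergyDensity (emeryLine cuprateSigns (emeryLineCoords 0 p)) ρ) emeryBoxSLCOClass := by
  have h := holdsOn_emeryEnergyFloor_of_lowerCorners (E := emeryBoxSLCOClass) (εp := 0) (eA := slcoClassEmery_tpd) (eB := slcoClassEmery_tpp)
    (eD := slcoClassEmery_Delta) (eUd := slcoClassEmery_Udd) (eUp := slcoClassEmery_Upp) rfl rfl rfl rfl rfl cuprateSigns ρ
    (m := ring8SLCOFloorLine ρ) (by rw [slcoClass_lowerCorner, ← ring8SLCOCorner_eq]; exact ring8SLCO_lineFloor h0 h1 h2 h3 hρ)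
  simpa using h

/-- **SLCO at its filling of record ρ = 51/40**: `e ≥ 5121/1600 = 3.2006250` eV per lattice site (`12.8025` eV/CuO₂; plus word 12.294) — given the nodes.
[cite: Anderson1951, eq. (2)] [cite: Israel1979, Thm. I.3.4] -/
theorem emeryBoxSLCOClass_cuprate_energyFloor_ring8_of_nodes (h0 : cert_emeryRing8_SLCOx_c0_j310438) (h1 : cert_emeryRing8_SLCOx_c1_j310438) (h2 : cert_emeryRing8_SLCOx_c2_j310438) (h3 : cert_emeryRing8_SLCOx_c3_j310438) :
    HoldsOn (fun p : EmeryCoord → ℝ =>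
      (5121/1600 : ℝ) ≤ emeryEnergyDensity (emeryLine cuprateSigns (emeryLineCoords 0 p)) (51 / 40)) emeryBoxSLCOClass := by
  have hρ : ((51 : ℝ) / 40) ∈ Set.Icc (0 : ℝ) (3/2) := by constructor <;> norm_num
  have h := emeryBoxSLCOClass_cuprate_energyFloorLine_ring8_of_nodes h0 h1 h2 h3 hρ
  have e : ring8SLCOFloorLine (51 / 40) = (5121/1600 : ℝ) := by norm_num [ring8SLCOFloorLine]
  rw [e] at h
  exact h

/-! ## NdNiO₂ U-slice box (La-proxy) -/

/-- My literal corner sheet of row 99 IS mod-4's `ndNiO2Dxy459YK26Corner`. [folklore] -/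
theorem ring8NdNiO2Corner_eq : ring8NdNiO2Corner = ndNiO2Dxy459YK26Corner := rfl

/-- **CONDITIONAL RING-8 FILLING-LINE WORD on `emeryBoxNdNiO2Dxy459YK26`**: for every fixed `ρ ∈ [0, 3/2]`,
`e(·, ρ) ≥ ring8NdNiO2FloorLine ρ` on the whole box — given the four claim nodes. [cite: Anderson1951, eq. (2)] [cite: Israel1979, Thm. I.3.4] -/
theorem emeryBoxNdNiO2Dxy459YK26_cuprate_energyFloorLine_ring8_of_nodes (h0 : cert_emeryRing8_NdNiO2x_c0_j310438) (h1 : cert_emeryRing8_NdNiO2x_c1_j310438) (h2 : cert_emeryRing8_NdNiO2x_c2_j310438) (h3 : cert_emeryRing8_NdNiO2x_c3_j310438) {ρ : ℝ}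
    (hρ : ρ ∈ Set.Icc (0 : ℝ) (3/2)) :
    HoldsOn (fun p : EmeryCoord → ℝ =>
      ring8NdNiO2FloorLine ρ ≤ emeryEnergyDensity (emeryLine cuprateSigns (emeryLineCoords 0 p)) ρ) emeryBoxNdNiO2Dxy459YK26 := by
  have h := holdsOn_emeryEnergyFloor_of_lowerCorners (E := emeryBoxNdNiO2Dxy459YK26) (εp := 0) (eA := ndNiO2YK26Emery_tpd) (eB := ndNiO2YK26Emery_tpp)
    (eD := ndNiO2Dxy459YK26Emery_Delta) (eUd := ndNiO2Dxy459YK26Emery_Udd) (eUp := ndNiO2Dxy459YK26Emery_Upp) (by simp [emeryBoxNdNiO2Dxy459YK26, emeryBoxNdNiO2Dxy459YK26Src, Function.update]) (by simp [emeryBoxNdNiO2Dxy459YK26, emeryBoxNdNiO2Dxy459YK26Src, Function.update]) (Function.update_self _ _ _) (by simp [emeryBoxNdNiO2Dxy459YK26, emeryBoxNdNiO2Dxy459YK26Src, Function.update]) (by simp [emeryBoxNdNiO2Dxy459YK26, emeryBoxNdNiO2Dxy459YK26Src, Function.update]) cuprateSigns ρ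
    (m := ring8NdNiO2FloorLine ρ) (by rw [ndNiO2Dxy459YK26_lowerCorner, ← ring8NdNiO2Corner_eq]; exact ring8NdNiO2_lineFloor h0 h1 h2 h3 hρ)
  simpa using h

/-- **NdNiO₂ at its filling of record ρ = 491/400**: `e ≥ 7997/3200 = 2.4990625` eV per lattice site (`9.9962` eV/NiO₂; plus word 9.3233) — given the nodes.
[cite: Anderson1951, eq. (2)] [cite: Israel1979, Thm. I.3.4] -/
theorem emeryBoxNdNiO2Dxy459YK26_cuprate_energyFloor_ring8_of_nodes (h0 : cert_emeryRing8_NdNiO2x_c0_j310438) (h1 : cert_emeryRing8_NdNiO2x_c1_j310438) (h2 : cert_emeryRing8_NdNiO2x_c2_j310438) (h3 : cert_emeryRing8_NdNiO2x_c3_j310438) :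
    HoldsOn (fun p : EmeryCoord → ℝ =>
      (7997/3200 : ℝ) ≤ emeryEnergyDensity (emeryLine cuprateSigns (emeryLineCoords 0 p)) (491 / 400)) emeryBoxNdNiO2Dxy459YK26 := by
  have hρ : ((491 : ℝ) / 400) ∈ Set.Icc (0 : ℝ) (3/2) := by constructor <;> norm_num
  have h := emeryBoxNdNiO2Dxy459YK26_cuprate_energyFloorLine_ring8_of_nodes h0 h1 h2 h3 hρ
  have e : ring8NdNiO2FloorLine (491 / 400) = (7997/3200 : ℝ) := by norm_num [ring8NdNiO2FloorLine]
  rw [e] at h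
  exact h

end Summit.Ventures.CertifiedManyBodySolver.Certificates

end
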